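import Mathlib
import Summits.CriticalPhenomena.PercolationContinuityZ3.Theorems.PercNearOneGluingNoHeavyLowerTailOrientedAntipodalHallStrictCyclic

/-!
# Three petals: the structure of a MINIMAL violator of CoI-Kleitman (the reduction behind the exact SAT census)

Helper file for crux `stmt-CriticalPhenomena-4575` (`NoHeavyLowerTail`, route `PercNearOneGluingNoHeavy`), hull-port seat `prim-hp-7`
(generation 59); `--supports stmt-CriticalPhenomena-4575`.  Everything here is PROVED; no definitions, no `sorry`.

Setting of `…OrientedAntipodalHall*`: `f` monotone into `Lab k`, ground set `S`, a co-intersecting family `D` of antipodal bads with types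
`(i X, j X)` among three petals `p, q, r`; the goods above `D` are the `U ⊆ S` with `f U = A`, `f (S \ U) = B` containing a member of `D`.
The only open type class on three petals is T6 (all six ordered types; `…CoIntThreePetals`, `…StrictCyclic`, `…StrictCyclicFails`).

**Theorem (`exists_minimal_violator`).**  If some co-intersecting family `D` of such bads has fewer goods above it than members, then
there is a sub-family `D' ⊆ D` (an inclusion-minimal violator) with
* `#goods(D') + 1 = #D'` (deficiency EXACTLY one),
* every ordered type `(p,q), (q,p), (p,r), (r,p), (q,r), (r,q)` occurs in `D'` (by the T5 theorem `card_le_card_goods_above_of_coint_fiveTypes`),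
* CLOSURE: for every `X ∈ D'` the goods above `D'.erase X` are exactly the goods above `D'` (no member has a private good),
* every proper sub-family of `D'` satisfies Hall's counting condition.
So the statement 'CoI-Kleitman holds for every three-petal labelling of an `n`-set' is equivalent to the non-existence of such a `D'`;
these are the implied constraints of the exact SAT census of generation 59 (memo `prim-hp-7/FROM-prim-hp-7-g59-*.md`), and the
starting point of any minimal-counterexample argument (`…NoTightSix`-type reductions).  (prim-hp-7 gen 59, 2026-08-22.)
-/

namespace Summit.CriticalPhenomena.PercolationContinuityZ3.Theorems

namespace OrientedAntipodalHall

open Finset AntipodalStrongHarris AntipodalStrongHarris.Lab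
open scoped FinsetFamily

variable {α : Type*} [DecidableEq α] {k : ℕ}

omit [DecidableEq α] in
/-- Bookkeeping: the 'types among `x, y, z`' hypothesis with the first two petals swapped. -/
theorem typesAmong_swap12 {D : Finset (Finset α)} {i j : Finset α → Fin k} {x y z : Fin k}
    (hP : ∀ X ∈ D, (i X = x ∨ i X = y ∨ i X = z) ∧ (j X = x ∨ j X = y ∨ j X = z)) :
    ∀ X ∈ D, (i X = y ∨ i X = x ∨ i X = z) ∧ (j X = y ∨ j X = x ∨ j X = z) := by
  intro X hX; obtain ⟨hi, hj⟩ := hP X hX; constructor <;> tauto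

omit [DecidableEq α] in
/-- Bookkeeping: the 'types among `x, y, z`' hypothesis with the last two petals swapped. -/
theorem typesAmong_swap23 {D : Finset (Finset α)} {i j : Finset α → Fin k} {x y z : Fin k}
    (hP : ∀ X ∈ D, (i X = x ∨ i X = y ∨ i X = z) ∧ (j X = x ∨ j X = y ∨ j X = z)) :
    ∀ X ∈ D, (i X = x ∨ i X = z ∨ i X = y) ∧ (j X = x ∨ j X = z ∨ j X = y) := by
  intro X hX; obtain ⟨hi, hj⟩ := hP X hX; constructor <;> tauto

/-- **Structure of an inclusion-minimal violator of CoI-Kleitman on three petals.**  See the module docstring. -/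
theorem exists_minimal_violator (S : Finset α) {f : Finset α → Lab k}
    (hf : ∀ ⦃X Y : Finset α⦄, X ⊆ Y → f X ≤ f Y) (i j : Finset α → Fin k)
    {p q r : Fin k} (hpq : p ≠ q) (hpr : p ≠ r) (hqr : q ≠ r)
    (D : Finset (Finset α)) (hDS : ∀ X ∈ D, X ⊆ S) (hDi : ∀ X ∈ D, f X = petal (i X))
    (hDj : ∀ X ∈ D, f (S \ X) = petal (j X)) (hij : ∀ X ∈ D, i X ≠ j X)
    (hP : ∀ X ∈ D, (i X = p ∨ i X = q ∨ i X = r) ∧ (j X = p ∨ j X = q ∨ j X = r))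
    (hco : ∀ X ∈ D, ∀ Y ∈ D, X ∪ Y ≠ S)
    (hviol : #{U ∈ S.powerset | f U = top ∧ f (S \ U) = bot ∧ ∃ X ∈ D, X ⊆ U} < #D) :
    ∃ D' ⊆ D,
      #{U ∈ S.powerset | f U = top ∧ f (S \ U) = bot ∧ ∃ X ∈ D', X ⊆ U} + 1 = #D' ∧
      ((∃ X ∈ D', i X = p ∧ j X = q) ∧ (∃ X ∈ D', i X = q ∧ j X = p) ∧ (∃ X ∈ D', i X = p ∧ j X = r) ∧
        (∃ X ∈ D', i X = r ∧ j X = p) ∧ (∃ X ∈ D', i X = q ∧ j X = r) ∧ (∃ X ∈ D', i X = r ∧ j X = q)) ∧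
      (∀ X ∈ D', {U ∈ S.powerset | f U = top ∧ f (S \ U) = bot ∧ ∃ Y ∈ D'.erase X, Y ⊆ U} =
        {U ∈ S.powerset | f U = top ∧ f (S \ U) = bot ∧ ∃ Y ∈ D', Y ⊆ U}) ∧
      (∀ D'' ⊂ D', #D'' ≤ #{U ∈ S.powerset | f U = top ∧ f (S \ U) = bot ∧ ∃ X ∈ D'', X ⊆ U}) := by
  classical
  -- notation for the goods above a family
  set N : Finset (Finset α) → Finset (Finset α) :=
    fun E => {U ∈ S.powerset | f U = top ∧ f (S \ U) = bot ∧ ∃ X ∈ E, X ⊆ U} with hN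
  have hNmono : ∀ {E E' : Finset (Finset α)}, E ⊆ E' → N E ⊆ N E' := by
    intro E E' hEE' U hU
    simp only [hN, mem_filter] at hU ⊢
    obtain ⟨hUS, hUt, hUb, X, hX, hXU⟩ := hU
    exact ⟨hUS, hUt, hUb, X, hEE' hX, hXU⟩
  -- the violating sub-families of `D`; pick one of minimal cardinality
  set V : Finset (Finset (Finset α)) := {E ∈ D.powerset | #(N E) < #E} with hV
  have hDV : D ∈ V := by
    rw [hV, mem_filter, mem_powerset]
    exact ⟨subset_refl D, hviol⟩
  obtain ⟨D', hD'V, hmin⟩ := exists_min_image V (fun E => #E) ⟨D, hDV⟩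
  rw [hV, mem_filter, mem_powerset] at hD'V
  obtain ⟨hD'D, hD'viol⟩ := hD'V
  -- hypotheses restricted to `D'`
  have hDS' : ∀ X ∈ D', X ⊆ S := fun X hX => hDS X (hD'D hX)
  have hDi' : ∀ X ∈ D', f X = petal (i X) := fun X hX => hDi X (hD'D hX)
  have hDj' : ∀ X ∈ D', f (S \ X) = petal (j X) := fun X hX => hDj X (hD'D hX)
  have hij' : ∀ X ∈ D', i X ≠ j X := fun X hX => hij X (hD'D hX)
  have hP' : ∀ X ∈ D', (i X = p ∨ i X = q ∨ i X = r) ∧ (j X = p ∨ j X = q ∨ j X = r) := fun X hX => hP X (hD'D hX)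
  have hco' : ∀ X ∈ D', ∀ Y ∈ D', X ∪ Y ≠ S := fun X hX Y hY => hco X (hD'D hX) Y (hD'D hY)
  -- proper sub-families satisfy Hall's counting condition
  have hHall : ∀ D'' ⊂ D', #D'' ≤ #(N D'') := by
    intro D'' hD''
    by_contra hlt
    rw [not_le] at hlt
    have hD''V : D'' ∈ V := by
      rw [hV, mem_filter, mem_powerset]
      exact ⟨hD''.1.trans hD'D, hlt⟩
    have := hmin D'' hD''V
    have := card_lt_card hD''
    omega
  -- `D'` is nonempty
  have hne : D'.Nonempty := by
    rw [nonempty_iff_ne_empty]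
    rintro rfl
    simp at hD'viol
  -- closure and exact deficiency
  have hclos : ∀ X ∈ D', N (D'.erase X) = N D' ∧ #(N D') + 1 = #D' := by
    intro X hX
    have hss : D'.erase X ⊂ D' := erase_ssubset hX
    have h1 : #(D'.erase X) ≤ #(N (D'.erase X)) := hHall _ hss
    have h2 : N (D'.erase X) ⊆ N D' := hNmono (erase_subset X D')
    have h3 : #(D'.erase X) + 1 = #D' := card_erase_add_one hX
    have h4 : #(N (D'.erase X)) ≤ #(N D') := card_le_card h2
    refine ⟨eq_of_subset_of_card_le h2 (by omega), by omega⟩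
  obtain ⟨X₀, hX₀⟩ := hne
  refine ⟨D', hD'D, (hclos X₀ hX₀).2, ?_, fun X hX => (hclos X hX).1, hHall⟩
  -- all six ordered types occur: otherwise T5 gives the Hall count for `D'` itself
  by_contra hall6
  have hT5 : ∀ {x y z : Fin k}, x ≠ y → x ≠ z → y ≠ z →
      (∀ X ∈ D', (i X = x ∨ i X = y ∨ i X = z) ∧ (j X = x ∨ j X = y ∨ j X = z)) →
      (∀ X ∈ D', ¬ (i X = x ∧ j X = y)) → #D' ≤ #(N D') := by
    intro x y z hxy hxz hyz hP'' hmiss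
    exact card_le_card_goods_above_of_coint_fiveTypes S hf D' i j hDS' hDi' hDj' (a := z) (b := y) (c := x)
      hyz.symm hxz.symm hxy.symm (fiveTypes_of_missing hP'' hij' hmiss) hco'
  have hPqpr := typesAmong_swap12 hP'
  have hPprq := typesAmong_swap23 hP'
  have hPrpq := typesAmong_swap12 hPprq
  have hPqrp := typesAmong_swap23 hPqpr
  have hPrqp := typesAmong_swap12 hPqrp
  have hle : #D' ≤ #(N D') := by
    simp only [not_and_or] at hall6
    rcases hall6 with h | h | h | h | h | h
    · exact hT5 hpq hpr hqr hP' (fun X hX hc => h ⟨X, hX, hc⟩)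
    · exact hT5 hpq.symm hqr hpr hPqpr (fun X hX hc => h ⟨X, hX, hc⟩)
    · exact hT5 hpr hpq hqr.symm hPprq (fun X hX hc => h ⟨X, hX, hc⟩)
    · exact hT5 hpr.symm hqr.symm hpq hPrpq (fun X hX hc => h ⟨X, hX, hc⟩)
    · exact hT5 hqr hpq.symm hpr.symm hPqrp (fun X hX hc => h ⟨X, hX, hc⟩)
    · exact hT5 hqr.symm hpr.symm hpq.symm hPrqp (fun X hX hc => h ⟨X, hX, hc⟩)
  exact absurd hD'viol (not_lt.mpr hle)

/-- **Corollary (the census form).**  If NO co-intersecting family of such bads on `S` has all six ordered types, deficiency exactly one,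
the closure property and Hall on its proper sub-families, then CoI-Kleitman holds for every co-intersecting family of such bads on `S`. -/
theorem card_le_card_goods_above_of_no_minimal_violator (S : Finset α) {f : Finset α → Lab k}
    (hf : ∀ ⦃X Y : Finset α⦄, X ⊆ Y → f X ≤ f Y) (i j : Finset α → Fin k)
    {p q r : Fin k} (hpq : p ≠ q) (hpr : p ≠ r) (hqr : q ≠ r)
    (hnone : ∀ D' : Finset (Finset α), (∀ X ∈ D', X ⊆ S) → (∀ X ∈ D', f X = petal (i X)) →
      (∀ X ∈ D', f (S \ X) = petal (j X)) →
      (∀ X ∈ D', (i X = p ∨ i X = q ∨ i X = r) ∧ (j X = p ∨ j X = q ∨ j X = r)) →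
      (∀ X ∈ D', ∀ Y ∈ D', X ∪ Y ≠ S) →
      #{U ∈ S.powerset | f U = top ∧ f (S \ U) = bot ∧ ∃ X ∈ D', X ⊆ U} + 1 = #D' →
      ((∃ X ∈ D', i X = p ∧ j X = q) ∧ (∃ X ∈ D', i X = q ∧ j X = p) ∧ (∃ X ∈ D', i X = p ∧ j X = r) ∧
        (∃ X ∈ D', i X = r ∧ j X = p) ∧ (∃ X ∈ D', i X = q ∧ j X = r) ∧ (∃ X ∈ D', i X = r ∧ j X = q)) →
      (∀ X ∈ D', {U ∈ S.powerset | f U = top ∧ f (S \ U) = bot ∧ ∃ Y ∈ D'.erase X, Y ⊆ U} =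
        {U ∈ S.powerset | f U = top ∧ f (S \ U) = bot ∧ ∃ Y ∈ D', Y ⊆ U}) →
      (∀ D'' ⊂ D', #D'' ≤ #{U ∈ S.powerset | f U = top ∧ f (S \ U) = bot ∧ ∃ X ∈ D'', X ⊆ U}) → False)
    (D : Finset (Finset α)) (hDS : ∀ X ∈ D, X ⊆ S) (hDi : ∀ X ∈ D, f X = petal (i X))
    (hDj : ∀ X ∈ D, f (S \ X) = petal (j X)) (hij : ∀ X ∈ D, i X ≠ j X)
    (hP : ∀ X ∈ D, (i X = p ∨ i X = q ∨ i X = r) ∧ (j X = p ∨ j X = q ∨ j X = r))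
    (hco : ∀ X ∈ D, ∀ Y ∈ D, X ∪ Y ≠ S) :
    #D ≤ #{U ∈ S.powerset | f U = top ∧ f (S \ U) = bot ∧ ∃ X ∈ D, X ⊆ U} := by
  classical
  by_contra hlt
  rw [not_le] at hlt
  obtain ⟨D', hD'D, h1, h2, h3, h4⟩ := exists_minimal_violator S hf i j hpq hpr hqr D hDS hDi hDj hij hP hco hlt
  exact hnone D' (fun X hX => hDS X (hD'D hX)) (fun X hX => hDi X (hD'D hX)) (fun X hX => hDj X (hD'D hX))
    (fun X hX => hP X (hD'D hX)) (fun X hX Y hY => hco X (hD'D hX) Y (hD'D hY)) h1 h2 h3 h4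

end OrientedAntipodalHall

end Summit.CriticalPhenomena.PercolationContinuityZ3.Theorems
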